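import Summits.AnomalousDissipation.AnomalousDissipation.Theorems.BaireTransferDenseLoudDesignerForcesErgodicModelSemigroup

/-!
# Iterates of the model map: continuity on an invariant set for all times, periodic orbits (registered tools stub S6i
# of the crux `DenseLoudDesignerForces`, line ergodic-budget-selection-closing, block N)

Glue over the exact local semigroup law `stub_modelSemigroupTools` (S6b) and the joint continuity of the model map on
`[0,3] × U` (S6a): on a `g`-invariant set `Λ ⊆ U` every `g t`, `t ≥ 0`, is continuous on `Λ` (write `t = r + 3n`,
`r ∈ [0,3)`, and `g (r + 3(n+1)) = g (r + 3n) ∘ g 3` on `Λ`); a point of `U` whose orbit stays in `U` on `[0,T]` and closes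
up at time `T` has a `T`-periodic orbit staying in `U` for all times.
-/

set_option linter.dupNamespace false

noncomputable section

open Set Function Filter
open scoped Topology

namespace Summit.AnomalousDissipation.AnomalousDissipation.Theorems.DenseLoudDesignerForces.Ergodic

open Literature.Analysis.FunctionSpaces Literature.Analysis.FunctionSpaces.Torus

/-- **Iterates of the model map** (registered tools stub S6i): continuity of every `g t` (`t ≥ 0`) on a `g`-invariant `Λ ⊆ U`,
and `T`-periodicity + confinement in `U` of the orbit of a point `z ∈ U` with `g T z = z` whose orbit stays in `U` on `[0,T]`.
[folklore] -/
theorem stub_modelIterateTools (F : ModelFrame) {ν : ℝ} (hν : 0 < ν) (xF : Hsp) {U U' : Set Hsp} (hUU' : U ⊆ U')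
    (htube : ∀ y ∈ U, ∀ t ∈ Icc (0 : ℝ) 3, ∃ (ht : 0 ≤ t) (z : C(Icc (0 : ℝ) t, Hsp)), F.IsMild ν xF ht y z ∧ ∀ r, z r ∈ U')
    (hcont : ContinuousOn (fun q : ℝ × Hsp => F.modelMap ν xF U' q.1 q.2) (Icc (0 : ℝ) 3 ×ˢ U)) :
    (∀ Λ : Set Hsp, Λ ⊆ U → (∀ t : ℝ, 0 ≤ t → MapsTo (F.modelMap ν xF U' t) Λ Λ) →
      ∀ t : ℝ, 0 ≤ t → ContinuousOn (F.modelMap ν xF U' t) Λ) ∧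
    (∀ z ∈ U, ∀ T : ℝ, 0 < T → (∀ t ∈ Icc 0 T, F.modelMap ν xF U' t z ∈ U) → F.modelMap ν xF U' T z = z →
      ∀ t : ℝ, 0 ≤ t → F.modelMap ν xF U' (t + T) z = F.modelMap ν xF U' t z ∧ F.modelMap ν xF U' t z ∈ U) := by
  obtain ⟨-, hadd⟩ := stub_modelSemigroupTools F hν xF hUU' htube
  -- sections of the jointly continuous map are continuous on `U` for `t ∈ [0,3]`
  have hsec : ∀ t ∈ Icc (0 : ℝ) 3, ContinuousOn (F.modelMap ν xF U' t) U := fun t ht =>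
    (hcont.comp (Continuous.prodMk_right t).continuousOn fun y hy => mk_mem_prod ht hy)
  refine ⟨fun Λ hΛU hmaps => ?_, fun z hz T hT horb hfix => ?_⟩
  · -- continuity of all iterates on the invariant set
    have key : ∀ n : ℕ, ∀ r ∈ Icc (0 : ℝ) 3, ContinuousOn (F.modelMap ν xF U' (r + 3 * n)) Λ := by
      intro n
      induction n with
      | zero => intro r hr; simpa using (hsec r hr).mono hΛU
      | succ n ih =>
        intro r hr
        have hr0 : 0 ≤ r + 3 * n := by have := hr.1; positivity
        -- `g (r + 3(n+1)) = g (r + 3n) ∘ g 3` on `Λ`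
        have heq : EqOn (F.modelMap ν xF U' (r + 3 * (n + 1 : ℕ)))
            (F.modelMap ν xF U' (r + 3 * n) ∘ F.modelMap ν xF U' 3) Λ := fun y hy => by
          have h3 : ∀ r' ∈ Icc (0 : ℝ) 3, F.modelMap ν xF U' r' y ∈ U := fun r' hr' => hΛU (hmaps r' hr'.1 hy)
          have := hadd (r + 3 * n) 3 hr0 (by norm_num) y (hΛU hy) h3
          simp only [Function.comp_apply, ← this]
          congr 1; push_cast; ring
        refine ContinuousOn.congr ?_ heq
        exact (ih r hr).comp ((hsec 3 (by norm_num)).mono hΛU) (hmaps 3 (by norm_num))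
    intro t ht
    -- `t = r + 3n` with `r ∈ [0,3)`
    obtain ⟨n, hn⟩ : ∃ n : ℕ, (3 * n : ℝ) ≤ t ∧ t < 3 * n + 3 := by
      refine ⟨⌊t / 3⌋₊, ?_, ?_⟩
      · have := Nat.floor_le (by positivity : 0 ≤ t / 3); linarith
      · have := Nat.lt_floor_add_one (t / 3); linarith
    have h := key n (t - 3 * n) ⟨by linarith, by linarith⟩
    simpa using h
  · -- periodic orbit: `g (t + T) z = g t (g T z) = g t z`
    have hper : ∀ t : ℝ, 0 ≤ t → F.modelMap ν xF U' (t + T) z = F.modelMap ν xF U' t z := fun t ht => by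
      rw [hadd t T ht hT.le z hz horb, hfix]
    -- confinement by induction on the number of periods
    have hmem : ∀ n : ℕ, ∀ t ∈ Icc (0 : ℝ) T, F.modelMap ν xF U' (t + n * T) z ∈ U ∧
        F.modelMap ν xF U' (t + n * T) z = F.modelMap ν xF U' t z := by
      intro n
      induction n with
      | zero => intro t ht; simpa using horb t ht
      | succ n ih =>
        intro t ht
        have ht0 : 0 ≤ t + n * T := by have := ht.1; have := hT.le; positivity
        have h1 : F.modelMap ν xF U' (t + (n + 1 : ℕ) * T) z = F.modelMap ν xF U' (t + n * T) z := by
          have := hper (t + n * T) ht0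
          rw [← this]; congr 1; push_cast; ring
        rw [h1]
        exact ih t ht
    intro t ht
    refine ⟨hper t ht, ?_⟩
    obtain ⟨n, hn⟩ : ∃ n : ℕ, (n * T : ℝ) ≤ t ∧ t < n * T + T := by
      refine ⟨⌊t / T⌋₊, ?_, ?_⟩
      · have := Nat.floor_le (by positivity : 0 ≤ t / T)
        calc (⌊t / T⌋₊ : ℝ) * T ≤ t / T * T := by gcongr
          _ = t := by field_simp
      · have h1 := Nat.lt_floor_add_one (t / T)
        have h2 : t = t / T * T := by field_simp
        nlinarith
    have h := (hmem n (t - n * T) ⟨by linarith, by linarith⟩).1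
    simpa using h

end Summit.AnomalousDissipation.AnomalousDissipation.Theorems.DenseLoudDesignerForces.Ergodic

end
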